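import Mathlib
import HarnessLib
import Summits.FinalStateConjecture.Statement
import Summits.FinalStateConjecture.FinalStateConjecture.Theses.BondiDrainDispersal

/-!
# Route BondiDrainDispersal — the Assembly (items stmt-FinalStateConjecture-9924 / stmt-FinalStateConjecture-17340)

The assembly item of route `BondiDrainDispersal` for the Final State Conjecture was, at rev 1, the frame
`CensoredHorizonlessDisperse → GenericCensoredHolesSettle → FinalStateConjecture` (stmt-9924), proved here by
`BondiDrainDispersal.assembly_frame_proof` with the two crux bodies INLINED VERBATIM (so that the closing module
did not import the route module — the import-cycle precaution of the EIHFluxBalance rev-3 / PhotonSphereChannels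
rev-3/4/6 / SwallowTheDatum rev-4 episodes).

**Repair 2026-08-17 (fullbuild breakage "93:66 / 94:9: Application type mismatch", four generations of fix
items).** The summit re-type T2 (p126844, 2026-08-16) changed `_root_.FinalStateConjecture` (TAME genericity on one
asymptotically flat end; honest near-zone radii, `RaysStayInClosure`, future-oriented charts), and route rev 4
(2026-08-16T23:16Z) restated the cruxes and the assembly accordingly: `Assembly` is now the LEAF form
`HorizonlessMustDrain → DrainImpliesDisperse → GenericCensoredHolesSettle → FinalStateConjecture`
(stmt-FinalStateConjecture-17340) — literally the type of the route's sorry-free deciding theorem `closes` (compose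
the two strokes into the dispersive branch, tame genericity is monotone in the property, horizon case split,
`Fin.elim0` at `N = 0`). The rev-1 theorem, whose inlined hypotheses are the PRE-re-type crux bodies (no
`RaysStayInClosure` / `IsFutureOriented`, plain genericity), no longer implies the re-typed Statement: it is dead as
stated. Theorems files are append-only (a recorded declaration is neither restated nor removed), so the repair
DEPRECATES: `bondiDrainDispersal_assembly_proof : Theses.BondiDrainDispersal.Assembly := closes` proves the live
item stmt-17340, and the old name `BondiDrainDispersal.assembly_frame_proof` (closing decl of record of stmt-9924)
is kept as a `@[deprecated]` alias of it. The route file no longer imports this module (the rev-1 closure survives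
there only as a comment), so importing the route module here is cycle-free; the gate records the new closure as a
docstring link.
-/

namespace Summit.FinalStateConjecture.FinalStateConjecture.Theorems

-- D-0017: single-problem summit, `Summit.<S>.<S>.…` by design; the Summits library sets
-- `weak.linter.dupNamespace = false`, repeated here for standalone elaboration (`lean check`).
set_option linter.dupNamespace false

/-- **Assembly of route BondiDrainDispersal, leaf form** (item stmt-FinalStateConjecture-17340, rev 4):
`HorizonlessMustDrain → DrainImpliesDisperse → GenericCensoredHolesSettle → FinalStateConjecture` — censored and
horizonless developments drain their Bondi mass, a vanishing final Bondi mass yields the honest `N = 0`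
decomposition, and the tame-generic holes branch settles; together they give the re-typed summit statement. This
was literally the type of the route's kernel-checked deciding theorem `Theses.BondiDrainDispersal.closes` until
its 2026-08-17 re-cut; the proof below is that composition written out for the rev-4 items. [folklore] -/
theorem bondiDrainDispersal_assembly_proof :
    Summit.FinalStateConjecture.FinalStateConjecture.Theses.BondiDrainDispersal.Assembly := by
  -- buildfix 2026-08-20 (proof only; statement byte-identical): the route's deciding theorem `closes`
  -- was re-cut (planner 2026-08-17) to the CK-restricted dispersive stroke `DrainImpliesDisperseCKH`
  -- and the wider generic branch `GenericCensoredHolesOrRoughSettle`; the leaf frame keeps the rev-4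
  -- items, whose composition is the SAME argument without the CK case split: horizon ⇒ the generic
  -- branch settles; no horizon ⇒ `HorizonlessMustDrain` drains the Bondi mass and
  -- `DrainImpliesDisperse` gives the honest `N = 0` decomposition (sub-extremality vacuous over
  -- `Fin 0`); then tame genericity is monotone in the property (verbatim tail of `closes`).
  unfold Summit.FinalStateConjecture.FinalStateConjecture.Theses.BondiDrainDispersal.Assembly
    Summit.FinalStateConjecture.FinalStateConjecture.Theses.BondiDrainDispersal.HorizonlessMustDrain
    Summit.FinalStateConjecture.FinalStateConjecture.Theses.BondiDrainDispersal.DrainImpliesDisperse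
    Summit.FinalStateConjecture.FinalStateConjecture.Theses.BondiDrainDispersal.GenericCensoredHolesSettle
    _root_.FinalStateConjecture
  intro hM hΔ hG X _ _ _ _ _ _ D hD
  have key : ∀ D' ∈ Literature.Geometry.Lorentzian.admissibleVacuumData X,
      ((∃ 𝒟 : Literature.Geometry.Lorentzian.VacuumCauchyDevelopment D', 𝒟.IsMaximal) ∧
        ∀ 𝒟 : Literature.Geometry.Lorentzian.VacuumCauchyDevelopment D', 𝒟.IsMaximal →
          Summit.FinalStateConjecture.HasCompleteNullInfinity 𝒟.toCauchyDevelopment ∧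
          ((∀ [𝒟.metric.HasLeviCivita], ∃ q : 𝒟.carrier, ∀ (p : X) (γ : ℝ → 𝒟.carrier) (dom : Set ℝ),
              𝒟.metric.IsNormalisedNullRayFrom 𝒟.timeOrientation 𝒟.embed 𝒟.normal p γ dom →
              ¬ BddAbove dom → q ∉ 𝒟.metric.chronologicalPast 𝒟.timeOrientation (γ '' (dom ∩ Set.Ici 0))) →
            ∃ (O : Set 𝒟.carrier) (d : Literature.Geometry.Lorentzian.FinalStateDecomposition 𝒟.toSpacetime O 2),
              (∀ i, Literature.Geometry.Lorentzian.Kerr.IsSubextremal (d.mass i) (d.spin i)) ∧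
              O = Summit.FinalStateConjecture.exteriorOf 𝒟.toCauchyDevelopment d.charted ∧
              Summit.FinalStateConjecture.RaysStayInClosure 𝒟.toCauchyDevelopment O ∧
              Summit.FinalStateConjecture.HasExhaustiveCharts d ∧
              Summit.FinalStateConjecture.IsFutureOriented d)) →
      ((∃ 𝒟 : Literature.Geometry.Lorentzian.VacuumCauchyDevelopment D', 𝒟.IsMaximal) ∧
        ∀ 𝒟 : Literature.Geometry.Lorentzian.VacuumCauchyDevelopment D', 𝒟.IsMaximal →
          Summit.FinalStateConjecture.HasCompleteNullInfinity 𝒟.toCauchyDevelopment ∧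
            ∃ (O : Set 𝒟.carrier) (d : Literature.Geometry.Lorentzian.FinalStateDecomposition 𝒟.toSpacetime O 2),
              (∀ i, Literature.Geometry.Lorentzian.Kerr.IsSubextremal (d.mass i) (d.spin i)) ∧
              O = Summit.FinalStateConjecture.exteriorOf 𝒟.toCauchyDevelopment d.charted ∧
              Summit.FinalStateConjecture.RaysStayInClosure 𝒟.toCauchyDevelopment O ∧
              Summit.FinalStateConjecture.HasExhaustiveCharts d ∧
              Summit.FinalStateConjecture.IsFutureOriented d) := by
    intro D' hD' h
    refine ⟨h.1, fun 𝒟 h𝒟 ↦ ⟨(h.2 𝒟 h𝒟).1, ?_⟩⟩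
    by_cases hH : (∀ [𝒟.metric.HasLeviCivita], ∃ q : 𝒟.carrier, ∀ (p : X) (γ : ℝ → 𝒟.carrier) (dom : Set ℝ),
        𝒟.metric.IsNormalisedNullRayFrom 𝒟.timeOrientation 𝒟.embed 𝒟.normal p γ dom →
        ¬ BddAbove dom → q ∉ 𝒟.metric.chronologicalPast 𝒟.timeOrientation (γ '' (dom ∩ Set.Ici 0)))
    · -- event horizon: the generic branch settles the exterior directly
      exact (h.2 𝒟 h𝒟).2 hH
    · -- no event horizon: the Bondi mass drains (`hM`) and the development disperses (`hΔ`) into an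
      -- honest `N = 0` decomposition carrying the same three T2 clauses
      obtain ⟨O, d, hN, hO, hR, hE, hF⟩ :=
        hΔ X D' hD' 𝒟 h𝒟 (h.2 𝒟 h𝒟).1 (hM X D' hD' 𝒟 h𝒟 (h.2 𝒟 h𝒟).1 hH)
      exact ⟨O, d, fun i ↦ (Fin.cast hN i).elim0, hO, hR, hE, hF⟩
  -- tame Christodoulou genericity is monotone in the property (same end, same admissible family)
  obtain ⟨e, F, hT, hImm, h0, hinj, hF𝓓, hE⟩ := hG X D ⟨hD.1, fun h ↦ hD.2 (key D hD.1 h)⟩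
  exact ⟨e, F, hT, hImm, h0, hinj, hF𝓓, fun c hc hmem ↦ hE c hc ⟨hmem.1, fun h ↦ hmem.2 (key _ hmem.1 h)⟩⟩

/-- **Deprecated record** of the closing theorem of the rev-1 frame stmt-FinalStateConjecture-9924 (formerly
`CensoredHorizonlessDisperse → GenericCensoredHolesSettle → FinalStateConjecture` with the PRE-re-type crux bodies
inlined verbatim): since the summit re-type T2 those hypotheses no longer imply `_root_.FinalStateConjecture`, so
the name is kept as an alias of the proof of the live leaf-form assembly (`bondiDrainDispersal_assembly_proof`,
stmt-17340). [folklore] -/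
@[deprecated bondiDrainDispersal_assembly_proof (since := "2026-08-17")]
alias BondiDrainDispersal.assembly_frame_proof := bondiDrainDispersal_assembly_proof

end Summit.FinalStateConjecture.FinalStateConjecture.Theorems
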